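import Literature.Computability.Cryptography.WordRAMEmulator
import HarnessLib

/-!
# The word RAM — while loops, and a verified routine computing `2 ^ (k · inputWidth)` of a segment

Inline simulations of oracle calls (V. Vassilevska Williams, ICM 2018, §2, the remark after
Def. 2.1) must run the oracle problem's algorithm at *its own* word size `k · inputWidth q` on
each query segment `q`, so the simulating program has to compute
`inputWidth q = Nat.size (max |q| (max entry, 1))` at run time — in `O(|q| + log W)` steps, since
`inputWidth` can be as large as the word size `W` and `O(W)` steps per query are not affordable.
This file provides

* `run_while`: the counting-loop block `loopBlock` of `…WordRAMBlocks` used as a *while* loop —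
  if the flag register is nonzero after `j < m` rounds of the body and zero after `m` rounds, the
  block exits after exactly `m * (|body| + 2) + 1` steps with memory `(execOps W · body)^[m] mem`;
* word arithmetic without wrap-around (`sub_eval_of_le`, …);
* `lmax` (maximum of a list) and its relation to `inputWidth` (`inputWidth_eq_size`);
* the routine `widthCode i₀ kk` (41 instructions at position `i₀`, fixed registers: inputs
  `16` = segment length `L`, `31` = segment address `p`; scratch `18 … 30`; output `30`) and its
  specification `run_widthCode`: it computes `2 ^ (kk * inputWidth (readSeg mem p L))` into
  register `30` (and `inputWidth …` into `26`) within `9 L + 20 · size W + 15` steps — a running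
  maximum over the segment (`scanBody`), an exponential search for a power of two `≥ size v`
  (`expBody`), and a binary search for `size v` (`binBody`), all branch-free inside their bodies.

## References

* V. Vassilevska Williams, *On some fine-grained questions in algorithms and complexity*,
  Proc. ICM 2018, §2.
* T. Hagerup, *Sorting and searching on the word RAM*, STACS 1998, §2.
-/

namespace Literature.Computability.Cryptography.WordRAM

open StateTransition


/-! ## While loops -/

/-- **While-loop execution.** The block `loopBlock i₀ RC body` (`jz (dir RC) exit; body; jmp i₀`)
run as a while loop: if the flag cell `RC` is nonzero after each of the first `m` rounds' starts
and zero after `m` rounds, then from `pc = i₀` the block reaches `pc = i₀ + |body| + 2` after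
exactly `m * (|body| + 2) + 1` steps with memory `(execOps w · body)^[m] mem`, coins and query
log unchanged. [folklore] -/
theorem run_while {P : Program} {w : ℕ} {O : List ℕ → List ℕ} {ρ : ℕ → ℕ} {i₀ RC : ℕ}
    {body : List OpSpec} (hcode : CodeAt P i₀ (loopBlock i₀ RC body)) :
    ∀ (m : ℕ) {c : Cfg}, c.pc = some i₀ →
      (∀ j, j < m → ((fun mem => execOps w mem body)^[j] c.mem) RC ≠ 0) →
      ((fun mem => execOps w mem body)^[m] c.mem) RC = 0 →
      run P w O ρ (m * (body.length + 2) + 1) c =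
        some { c with pc := some (i₀ + body.length + 2),
                      mem := (fun mem => execOps w mem body)^[m] c.mem } := by
  have hjz : P[i₀]? = some (.jz (.dir RC) (i₀ + body.length + 2)) :=
    (codeAt_append_iff.1 (codeAt_append_iff.1 hcode).1).1.getElem?_zero
  have hops : CodeAt P (i₀ + 1) (body.map OpSpec.toInstr) := by
    have := (codeAt_append_iff.1 (codeAt_append_iff.1 hcode).1).2
    simpa using this
  have hjmp : P[i₀ + 1 + body.length]? = some (.jmp i₀) := by
    have := (codeAt_append_iff.1 hcode).2
    simp only [List.length_append, List.length_cons, List.length_nil, List.length_map] at this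
    have h := this.getElem?_zero
    simpa [Nat.add_assoc, Nat.add_comm, Nat.add_left_comm] using h
  intro m
  induction m with
  | zero =>
    intro c hpc _ hz
    have h0 : (Operand.dir RC).read c.mem = 0 := by simpa using hz
    rw [Nat.zero_mul, Nat.zero_add, run_one, step_jz_zero hpc hjz h0]
    simp
  | succ m ih =>
    intro c hpc hnz hz
    have hne : (Operand.dir RC).read c.mem ≠ 0 := by simpa using hnz 0 (Nat.succ_pos _)
    set mem₁ : ℕ → ℕ := execOps w c.mem body with hmem₁
    have h1 : step P w O ρ c = some { c with pc := some (i₀ + 1) } := step_jz_ne hpc hjz hne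
    have h2 := run_ops (P := P) (w := w) (O := O) (ρ := ρ) body hops
      (c := { c with pc := some (i₀ + 1) }) rfl
    have h3 : step P w O ρ { c with pc := some (i₀ + 1 + body.length), mem := mem₁ } =
        some { c with pc := some i₀, mem := mem₁ } :=
      step_jmp rfl hjmp
    have h4 := ih (c := { c with pc := some i₀, mem := mem₁ }) rfl
      (fun j hj => by simpa [Function.iterate_succ_apply] using hnz (j + 1) (by omega))
      (by simpa [Function.iterate_succ_apply] using hz)
    have hsteps : (m + 1) * (body.length + 2) + 1 =
        ((body.length + 1) + (m * (body.length + 2) + 1)) + 1 := by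
      rw [Nat.succ_mul]; omega
    rw [hsteps, run_succ_of_step _ _ _ _ h1,
      run_add_of_run _ _ _ _ (run_add_of_run _ _ _ _ h2 (by rw [run_one, h3])) h4,
      Function.iterate_succ_apply]

/-! ## Word arithmetic without wrap-around -/

/-- Subtraction of `y ≤ x < 2 ^ W` does not wrap. [folklore] -/
theorem sub_eval_of_le {W x y : ℕ} (hyx : y ≤ x) (hx : x < 2 ^ W) :
    (x + 2 ^ W - y % 2 ^ W) % 2 ^ W = x - y := by
  rw [Nat.mod_eq_of_lt (lt_of_le_of_lt hyx hx)]
  rw [show x + 2 ^ W - y = (x - y) + 2 ^ W by omega, Nat.add_mod_right, Nat.mod_eq_of_lt (by omega)]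

/-- Subtraction of `y > x` (`x, y < 2 ^ W`) wraps to `x + 2 ^ W - y`. [folklore] -/
theorem sub_eval_of_lt {W x y : ℕ} (hxy : x < y) (hy : y < 2 ^ W) :
    (x + 2 ^ W - y % 2 ^ W) % 2 ^ W = x + 2 ^ W - y := by
  rw [Nat.mod_eq_of_lt hy, Nat.mod_eq_of_lt (by omega)]

/-- `2 * W < 2 ^ W` for `W ≥ 3`. [folklore] -/
theorem two_mul_lt_two_pow {W : ℕ} (hW : 3 ≤ W) : 2 * W < 2 ^ W := by
  obtain ⟨k, rfl⟩ := Nat.exists_eq_add_of_le hW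
  induction k with
  | zero => decide
  | succ k ih =>
    rw [show 3 + (k + 1) = (3 + k) + 1 by omega, Nat.pow_succ]
    omega

/-! ## Maxima of lists and `inputWidth` -/

/-- The maximum of a list of naturals (`0` for the empty list). [folklore] -/
def lmax (l : List ℕ) : ℕ := l.foldr max 0

/-- `lmax` of the empty list. [folklore] -/
@[simp] theorem lmax_nil : lmax [] = 0 := rfl
/-- `lmax` of a cons. [folklore] -/
@[simp] theorem lmax_cons (a : ℕ) (l : List ℕ) : lmax (a :: l) = max a (lmax l) := rfl

/-- `lmax` of a concatenation. [folklore] -/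
theorem lmax_append (l₁ l₂ : List ℕ) : lmax (l₁ ++ l₂) = max (lmax l₁) (lmax l₂) := by
  induction l₁ with
  | nil => simp
  | cons a l ih => simp [ih, max_assoc]

/-- A right fold of `max` is the maximum of the seed and `lmax`. [folklore] -/
theorem foldr_max_eq (b : ℕ) (l : List ℕ) : l.foldr max b = max b (lmax l) := by
  induction l with
  | nil => simp
  | cons a l ih => simp only [List.foldr_cons, ih, lmax_cons]; rw [max_left_comm]

/-- A left fold of `max` is the maximum of the seed and `lmax`. [folklore] -/
theorem foldl_max_eq (b : ℕ) (l : List ℕ) : l.foldl max b = max b (lmax l) := by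
  induction l generalizing b with
  | nil => simp
  | cons a l ih => simp only [List.foldl_cons, ih, lmax_cons, max_assoc]

/-- Members are at most `lmax`. [folklore] -/
theorem le_lmax_of_mem {l : List ℕ} {a : ℕ} (h : a ∈ l) : a ≤ lmax l := by
  induction l with
  | nil => simp at h
  | cons b l ih =>
    rw [lmax_cons]
    rcases List.mem_cons.1 h with rfl | h
    · exact le_max_left _ _
    · exact le_trans (ih h) (le_max_right _ _)

/-- `lmax` is bounded by any common bound of the members. [folklore] -/
theorem lmax_le {l : List ℕ} {V : ℕ} (h : ∀ a ∈ l, a ≤ V) : lmax l ≤ V := by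
  induction l with
  | nil => simp
  | cons b l ih =>
    rw [lmax_cons]
    exact max_le (h b (by simp)) (ih fun a ha => h a (by simp [ha]))

/-- `inputWidth q = size (max |q| (max 1 (lmax q)))`. [folklore] -/
theorem inputWidth_eq_size (q : List ℕ) :
    inputWidth q = Nat.size (max (max q.length 1) (lmax q)) := by
  rw [inputWidth, foldr_max_eq, max_assoc]

/-- The quantity whose size is the input width is bounded by any common bound `≥ 1` of the length
and the entries. [folklore] -/
theorem widthArg_le {q : List ℕ} {V : ℕ} (hL : q.length ≤ V) (h1 : 1 ≤ V) (hq : ∀ a ∈ q, a ≤ V) :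
    max (max q.length 1) (lmax q) ≤ V :=
  max_le (max_le hL h1) (lmax_le hq)

/-- `inputWidth q ≤ size V` for any common bound `V ≥ 1` of the length and the entries. [folklore] -/
theorem inputWidth_le_size {q : List ℕ} {V : ℕ} (hL : q.length ≤ V) (h1 : 1 ≤ V)
    (hq : ∀ a ∈ q, a ≤ V) : inputWidth q ≤ Nat.size V := by
  rw [inputWidth_eq_size]; exact Nat.size_le_size (widthArg_le hL h1 hq)

/-- `readSeg` one cell longer. [folklore] -/
theorem readSeg_succ (mem : ℕ → ℕ) (p j : ℕ) :
    readSeg mem p (j + 1) = readSeg mem p j ++ [mem (p + j)] := by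
  simp [readSeg, List.range_succ]

/-- Entries of a segment are cells. [folklore] -/
theorem mem_readSeg_iff {mem : ℕ → ℕ} {p L a : ℕ} :
    a ∈ readSeg mem p L ↔ ∃ j, j < L ∧ mem (p + j) = a := by
  simp [readSeg]

/-! ## Shifts and `Nat.size` -/

/-- A right shift vanishes iff the shift is at least the bit size. [folklore] -/
theorem shiftRight_eq_zero_iff {v s : ℕ} : v >>> s = 0 ↔ Nat.size v ≤ s := by
  rw [Nat.shiftRight_eq_div_pow, Nat.div_eq_zero_iff, Nat.size_le]
  simp

/-- A right shift is nonzero iff the shift is below the bit size. [folklore] -/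
theorem shiftRight_ne_zero_iff {v s : ℕ} : v >>> s ≠ 0 ↔ s < Nat.size v := by
  rw [Ne, shiftRight_eq_zero_iff, not_le]

/-- The number of doublings of the exponential search: the least `j` with `v >>> 2 ^ j = 0`. [folklore] -/
noncomputable def expIters (v : ℕ) : ℕ := by
  classical
  exact Nat.find (p := fun j => v >>> 2 ^ j = 0) ⟨v, by
    rw [shiftRight_eq_zero_iff, Nat.size_le]
    exact lt_of_lt_of_le v.lt_two_pow_self (Nat.pow_le_pow_right (by norm_num) v.lt_two_pow_self.le)⟩

/-- The exponential search stops at a vanishing probe. [folklore] -/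
theorem expIters_spec (v : ℕ) : v >>> 2 ^ expIters v = 0 := by
  classical
  exact Nat.find_spec (p := fun j => v >>> 2 ^ j = 0) _

/-- Before the exponential search stops, the probes are nonzero. [folklore] -/
theorem expIters_min {v j : ℕ} (hj : j < expIters v) : v >>> 2 ^ j ≠ 0 := by
  classical
  exact Nat.find_min (p := fun j => v >>> 2 ^ j = 0) _ hj

/-- The bit size is at most `2 ^ expIters`. [folklore] -/
theorem size_le_two_pow_expIters (v : ℕ) : Nat.size v ≤ 2 ^ expIters v :=
  shiftRight_eq_zero_iff.1 (expIters_spec v)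

/-- `2 ^ expIters v ≤ 2 * size v` for `v ≥ 1`. [folklore] -/
theorem two_pow_expIters_le {v : ℕ} (hv : 1 ≤ v) : 2 ^ expIters v ≤ 2 * Nat.size v := by
  have hs : 1 ≤ Nat.size v := Nat.size_pos.2 hv
  rcases h : expIters v with _ | m
  · simp; omega
  · have := expIters_min (v := v) (j := m) (by omega)
    rw [shiftRight_ne_zero_iff] at this
    rw [Nat.pow_succ]; omega

/-- `expIters v ≤ size (size v)` for `v ≥ 1` (so the searches take `O(log W)` rounds). [folklore] -/
theorem expIters_le {v : ℕ} (hv : 1 ≤ v) : expIters v ≤ Nat.size (Nat.size v) := by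
  have h := two_pow_expIters_le hv
  have hs : 1 ≤ Nat.size v := Nat.size_pos.2 hv
  -- `2 ^ e ≤ 2 s` gives `e < size (2 s) = size s + 1`
  have h1 : expIters v < Nat.size (2 * Nat.size v) := Nat.lt_size.2 h
  have h2 : Nat.size (2 * Nat.size v) = Nat.size (Nat.size v) + 1 := by
    have := Nat.size_shiftLeft (m := Nat.size v) (by omega) 1
    simpa [Nat.shiftLeft_eq, Nat.mul_comm] using this
  omega

/-- One step of the binary search for `size v` on the bracket `(lo, hi]`. [folklore] -/
def bstep (v : ℕ) (lh : ℕ × ℕ) : ℕ × ℕ :=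
  let mid := lh.1 + (lh.2 - lh.1) / 2
  if v >>> mid = 0 then (lh.1, mid) else (mid, lh.2)

/-- The bracket after `j` steps of the binary search from `(0, 2 ^ e]`. [folklore] -/
def bIter (v e j : ℕ) : ℕ × ℕ := (bstep v)^[j] (0, 2 ^ e)

/-- The binary-search invariant: from `(0, 2 ^ e]` with `size v ≤ 2 ^ e` and `v ≥ 1`, after
`j ≤ e` steps the bracket `(lo, hi]` contains `size v` and has width `2 ^ (e - j)`. [folklore] -/
theorem bIter_inv {v e : ℕ} (hv : 1 ≤ v) (he : Nat.size v ≤ 2 ^ e) :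
    ∀ j, j ≤ e → (bIter v e j).1 < Nat.size v ∧ Nat.size v ≤ (bIter v e j).2 ∧
      (bIter v e j).2 = (bIter v e j).1 + 2 ^ (e - j) ∧ (bIter v e j).2 ≤ 2 ^ e
  | 0, _ => by
      simp only [bIter, Function.iterate_zero, id_eq, Nat.sub_zero, Nat.zero_add]
      exact ⟨Nat.size_pos.2 hv, he, trivial, le_rfl⟩
  | j + 1, hj => by
      obtain ⟨h1, h2, h3, h4⟩ := bIter_inv hv he j (by omega)
      have hstep : bIter v e (j + 1) = bstep v (bIter v e j) := by
        simp only [bIter, Function.iterate_succ_apply']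
      rw [hstep]
      rcases hp : bIter v e j with ⟨lo, hi⟩
      rw [hp] at h1 h2 h3 h4
      simp only at h1 h2 h3 h4
      have hgap : (hi - lo) / 2 = 2 ^ (e - (j + 1)) := by
        rw [h3, Nat.add_sub_cancel_left, show e - j = (e - (j + 1)) + 1 by omega, Nat.pow_succ]
        omega
      simp only [bstep, hgap]
      split_ifs with hz
      · rw [shiftRight_eq_zero_iff] at hz
        exact ⟨h1, hz, rfl, by omega⟩
      · rw [← Ne, shiftRight_ne_zero_iff] at hz
        refine ⟨hz, h2, ?_, h4⟩
        rw [h3, show e - j = (e - (j + 1)) + 1 by omega, Nat.pow_succ]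
        omega

/-- After `e` steps the binary search has found `size v`. [folklore] -/
theorem bIter_final {v e : ℕ} (hv : 1 ≤ v) (he : Nat.size v ≤ 2 ^ e) :
    (bIter v e e).2 = Nat.size v := by
  obtain ⟨h1, h2, h3, -⟩ := bIter_inv hv he e le_rfl
  simp only [Nat.sub_self, Nat.pow_zero] at h3
  omega

/-! ## The routine -/

section widthCode

/-- Running maximum: `RT := mem[RQ]; RF := (RV < RT); RD := RT - RV; RD *= RF; RV += RD; RQ += 1;
RC -= 1` (registers `RV = 18, RQ = 19, RC = 20, RT = 21, RF = 22, RD = 23`). [folklore] -/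
def scanBody : List OpSpec :=
  [(.div, .dir 21, .ind 19, .imm 1), (.lt, .dir 22, .dir 18, .dir 21), (.sub, .dir 23, .dir 21, .dir 18),
   (.mul, .dir 23, .dir 23, .dir 22), (.add, .dir 18, .dir 18, .dir 23), (.add, .dir 19, .dir 19, .imm 1),
   (.sub, .dir 20, .dir 20, .imm 1)]

/-- Set-up: `RV := max L 1` (`RV := L; RT := (RV = 0); RV += RT`), `RC := L`, `RQ := p`
(inputs `L` in register `16`, `p` in register `31`). [folklore] -/
def wInit : List OpSpec :=
  [(.div, .dir 18, .dir 16, .imm 1), (.eq, .dir 21, .dir 18, .imm 0), (.add, .dir 18, .dir 18, .dir 21),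
   (.div, .dir 20, .dir 16, .imm 1), (.div, .dir 19, .dir 31, .imm 1)]

/-- Exponential search set-up: `RM := 1; RC := RV >>> RM` (`RM = 24`). [folklore] -/
def expInit : List OpSpec :=
  [(.div, .dir 24, .imm 1, .imm 1), (.shr, .dir 20, .dir 18, .dir 24)]

/-- Exponential search round: `RM += RM; RC := RV >>> RM`. [folklore] -/
def expBody : List OpSpec :=
  [(.add, .dir 24, .dir 24, .dir 24), (.shr, .dir 20, .dir 18, .dir 24)]

/-- Binary search set-up: `RLO := 0; RHI := RM; RGAP := RHI >>> 1`
(`RLO = 25, RHI = 26, RGAP = 27`). [folklore] -/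
def binInit : List OpSpec :=
  [(.div, .dir 25, .imm 0, .imm 1), (.div, .dir 26, .dir 24, .imm 1), (.shr, .dir 27, .dir 26, .imm 1)]

/-- Binary search round, part 1 (`RMID = 28, RZ = 29`):
`RGAP := RHI - RLO; RMID := RGAP >>> 1; RMID += RLO; RT := RV >>> RMID; RZ := (RT = 0)`. [folklore] -/
def binBody₁ : List OpSpec :=
  [(.sub, .dir 27, .dir 26, .dir 25), (.shr, .dir 28, .dir 27, .imm 1), (.add, .dir 28, .dir 25, .dir 28),
   (.shr, .dir 21, .dir 18, .dir 28), (.eq, .dir 29, .dir 21, .imm 0)]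

/-- Binary search round, part 2: `RT := RHI - RMID; RT *= RZ; RHI -= RT`. [folklore] -/
def binBody₂ : List OpSpec :=
  [(.sub, .dir 21, .dir 26, .dir 28), (.mul, .dir 21, .dir 21, .dir 29), (.sub, .dir 26, .dir 26, .dir 21)]

/-- Binary search round, part 3:
`RZ := (RZ = 0); RT := RMID - RLO; RT *= RZ; RLO += RT; RGAP := RHI - RLO; RGAP >>>= 1`. [folklore] -/
def binBody₃ : List OpSpec :=
  [(.eq, .dir 29, .dir 29, .imm 0), (.sub, .dir 21, .dir 28, .dir 25), (.mul, .dir 21, .dir 21, .dir 29),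
   (.add, .dir 25, .dir 25, .dir 21), (.sub, .dir 27, .dir 26, .dir 25), (.shr, .dir 27, .dir 27, .imm 1)]

/-- Binary search round (branch-free): with `mid := lo + (hi - lo) / 2` and `z := (v >>> mid = 0)`,
`hi := hi - z (hi - mid)`, `lo := lo + (1 - z) (mid - lo)`, `RGAP := (hi - lo) >>> 1`. [folklore] -/
def binBody : List OpSpec :=
  binBody₁ ++ binBody₂ ++ binBody₃

/-- Output: `ROUT := kk * RHI; ROUT := 1 <<< ROUT` (`ROUT = 30`). [folklore] -/
def powOps (kk : ℕ) : List OpSpec :=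
  [(.mul, .dir 30, .dir 26, .imm kk), (.shl, .dir 30, .imm 1, .dir 30)]

/-- Length of `wInit`. [folklore] -/
@[simp] theorem wInit_length : wInit.length = 5 := rfl
/-- Length of `scanBody`. [folklore] -/
@[simp] theorem scanBody_length : scanBody.length = 7 := rfl
/-- Length of `expInit`. [folklore] -/
@[simp] theorem expInit_length : expInit.length = 2 := rfl
/-- Length of `expBody`. [folklore] -/
@[simp] theorem expBody_length : expBody.length = 2 := rfl
/-- Length of `binInit`. [folklore] -/
@[simp] theorem binInit_length : binInit.length = 3 := rfl
/-- Length of `binBody`. [folklore] -/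
@[simp] theorem binBody_length : binBody.length = 14 := rfl
/-- Length of `powOps`. [folklore] -/
@[simp] theorem powOps_length (kk : ℕ) : (powOps kk).length = 2 := rfl

/-- **The width routine** at position `i₀`: computes `2 ^ (kk * inputWidth q)` of the segment `q`
of length `mem 16` at address `mem 31` into register `30` (and `inputWidth q` into `26`).
41 instructions. [folklore] -/
def widthCode (i₀ kk : ℕ) : List Instr :=
  wInit.map OpSpec.toInstr ++ loopBlock (i₀ + 5) 20 scanBody ++ expInit.map OpSpec.toInstr ++
    loopBlock (i₀ + 16) 20 expBody ++ binInit.map OpSpec.toInstr ++ loopBlock (i₀ + 23) 27 binBody ++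
    (powOps kk).map OpSpec.toInstr

/-- Length of `widthCode` (41 instructions). [folklore] -/
@[simp] theorem widthCode_length (i₀ kk : ℕ) : (widthCode i₀ kk).length = 41 := by
  simp [widthCode]

/-- The `0`-test of a `0/1` value, as arithmetic (instance-polymorphic, for rewriting inside
symbolically executed code). [folklore] -/
theorem ite_eq_zero_eq_one_sub {x : ℕ} (hx : x ≤ 1) {inst : Decidable (x = 0)} :
    @ite ℕ (x = 0) inst 1 0 = 1 - x := by
  rcases Nat.le_one_iff_eq_zero_or_eq_one.1 hx with rfl | rfl <;> simp

/-! ### The bodies -/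

/-- Semantics of the scan initialisation. [folklore] -/
theorem execOps_wInit {W : ℕ} (mem : ℕ → ℕ) (hL : mem 16 + 1 < 2 ^ W) :
    (execOps W mem wInit) 18 = max (mem 16) 1 ∧ (execOps W mem wInit) 20 = mem 16 ∧
      (execOps W mem wInit) 19 = mem 31 ∧
      ∀ a, a ≠ 18 → a ≠ 19 → a ≠ 20 → a ≠ 21 → (execOps W mem wInit) a = mem a := by
  simp only [wInit, execOps_cons, execOps_nil, execOp_dir, Operand.read_dir,
    Operand.read_imm, BinOp.eval]
  simp (config := { decide := true }) only [Function.update_self, Function.update_of_ne, ne_eq,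
    Nat.div_one]
  refine ⟨?_, by trivial, by trivial, fun a h18 h19 h20 h21 => ?_⟩
  · split_ifs with h
    · rw [h]; simp [Nat.mod_eq_of_lt (show 1 < 2 ^ W by omega)]
    · rw [Nat.add_zero, Nat.mod_eq_of_lt (by omega), Nat.max_eq_left (by omega)]
  · simp (config := { decide := true }) only [Function.update_of_ne, ne_eq, h18, h19, h20, h21,
      not_false_eq_true]

/-- Semantics of one round of the maximum scan. [folklore] -/
theorem execOps_scanBody {W : ℕ} (mem : ℕ → ℕ) (hv : mem 18 < 2 ^ W) (hc : mem (mem 19) < 2 ^ W)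
    (hq : mem 19 + 1 < 2 ^ W) (hcnt : 1 ≤ mem 20) (hcnt' : mem 20 < 2 ^ W) :
    (execOps W mem scanBody) 18 = max (mem 18) (mem (mem 19)) ∧
      (execOps W mem scanBody) 19 = mem 19 + 1 ∧
      (execOps W mem scanBody) 20 = mem 20 - 1 ∧
      ∀ a, a ≠ 18 → a ≠ 19 → a ≠ 20 → a ≠ 21 → a ≠ 22 → a ≠ 23 →
        (execOps W mem scanBody) a = mem a := by
  simp only [scanBody, execOps_cons, execOps_nil, execOp_dir, Operand.read_dir, Operand.read_ind,
    Operand.read_imm, BinOp.eval]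
  simp (config := { decide := true }) only [Function.update_self, Function.update_of_ne, ne_eq,
    Nat.div_one]
  refine ⟨?_, Nat.mod_eq_of_lt hq, sub_eval_of_le hcnt hcnt', fun a h18 h19 h20 h21 h22 h23 => ?_⟩
  · by_cases h : mem 18 < mem (mem 19)
    · rw [if_pos h, sub_eval_of_le h.le hc, Nat.mul_one,
        Nat.mod_eq_of_lt (a := mem (mem 19) - mem 18) (by omega),
        Nat.mod_eq_of_lt (by omega), Nat.max_eq_right h.le]
      omega
    · rw [if_neg h, Nat.mul_zero, Nat.zero_mod, Nat.add_zero, Nat.mod_eq_of_lt hv,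
        Nat.max_eq_left (not_lt.1 h)]
  · simp (config := { decide := true }) only [Function.update_of_ne, ne_eq, h18, h19, h20, h21, h22,
      h23, not_false_eq_true]

/-- Semantics of the exponential-search initialisation. [folklore] -/
theorem execOps_expInit {W : ℕ} (mem : ℕ → ℕ) :
    (execOps W mem expInit) 24 = 1 ∧ (execOps W mem expInit) 20 = mem 18 >>> 1 ∧
      ∀ a, a ≠ 20 → a ≠ 24 → (execOps W mem expInit) a = mem a := by
  simp only [expInit, execOps_cons, execOps_nil, execOp_dir, Operand.read_dir,
    Operand.read_imm, BinOp.eval]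
  simp (config := { decide := true }) only [Function.update_self, Function.update_of_ne, ne_eq,
    Nat.div_one]
  refine ⟨by trivial, by trivial, fun a h20 h24 => ?_⟩
  simp (config := { decide := true }) only [Function.update_of_ne, ne_eq, h20, h24, not_false_eq_true]

/-- Semantics of one round of the exponential search. [folklore] -/
theorem execOps_expBody {W : ℕ} (mem : ℕ → ℕ) (hm : mem 24 + mem 24 < 2 ^ W) :
    (execOps W mem expBody) 24 = mem 24 + mem 24 ∧
      (execOps W mem expBody) 20 = mem 18 >>> (mem 24 + mem 24) ∧
      ∀ a, a ≠ 20 → a ≠ 24 → (execOps W mem expBody) a = mem a := by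
  simp only [expBody, execOps_cons, execOps_nil, execOp_dir, Operand.read_dir,
    BinOp.eval]
  simp (config := { decide := true }) only [Function.update_self, Function.update_of_ne, ne_eq]
  refine ⟨Nat.mod_eq_of_lt hm, by rw [Nat.mod_eq_of_lt hm], fun a h20 h24 => ?_⟩
  simp (config := { decide := true }) only [Function.update_of_ne, ne_eq, h20, h24, not_false_eq_true]

/-- Semantics of the binary-search initialisation. [folklore] -/
theorem execOps_binInit {W : ℕ} (mem : ℕ → ℕ) :
    (execOps W mem binInit) 25 = 0 ∧ (execOps W mem binInit) 26 = mem 24 ∧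
      (execOps W mem binInit) 27 = mem 24 >>> 1 ∧
      ∀ a, a ≠ 25 → a ≠ 26 → a ≠ 27 → (execOps W mem binInit) a = mem a := by
  simp only [binInit, execOps_cons, execOps_nil, execOp_dir, Operand.read_dir,
    Operand.read_imm, BinOp.eval]
  simp (config := { decide := true }) only [Function.update_self, Function.update_of_ne, ne_eq,
    Nat.div_one]
  refine ⟨by trivial, by trivial, by trivial, fun a h25 h26 h27 => ?_⟩
  simp (config := { decide := true }) only [Function.update_of_ne, ne_eq, h25, h26, h27,
    not_false_eq_true]

/-- Semantics of one round of the binary search (set-up of the probe). [folklore] -/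
theorem execOps_binBody₁ {W : ℕ} (mem : ℕ → ℕ) (hlh : mem 25 ≤ mem 26) (hhi : mem 26 < 2 ^ W) :
    (execOps W mem binBody₁) 28 = mem 25 + (mem 26 - mem 25) / 2 ∧
      (execOps W mem binBody₁) 29 =
        (if mem 18 >>> (mem 25 + (mem 26 - mem 25) / 2) = 0 then 1 else 0) ∧
      (execOps W mem binBody₁) 25 = mem 25 ∧ (execOps W mem binBody₁) 26 = mem 26 ∧
      (execOps W mem binBody₁) 18 = mem 18 ∧
      ∀ a, a ≠ 21 → a ≠ 27 → a ≠ 28 → a ≠ 29 → (execOps W mem binBody₁) a = mem a := by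
  simp only [binBody₁, execOps_cons, execOps_nil, execOp_dir, Operand.read_dir, Operand.read_imm,
    BinOp.eval]
  simp (config := { decide := true }) only [Function.update_self, Function.update_of_ne, ne_eq]
  have hgap : (mem 26 + 2 ^ W - mem 25 % 2 ^ W) % 2 ^ W = mem 26 - mem 25 :=
    sub_eval_of_le hlh hhi
  have hhalf : (mem 26 - mem 25) >>> 1 = (mem 26 - mem 25) / 2 := by
    rw [Nat.shiftRight_eq_div_pow, Nat.pow_one]
  have hmid : (mem 25 + (mem 26 - mem 25) / 2) % 2 ^ W = mem 25 + (mem 26 - mem 25) / 2 :=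
    Nat.mod_eq_of_lt (by omega)
  rw [hgap, hhalf, hmid]
  refine ⟨by trivial, by trivial, by trivial, by trivial, by trivial, fun a h21 h27 h28 h29 => ?_⟩
  simp (config := { decide := true }) only [Function.update_of_ne, ne_eq, h21, h27, h28, h29,
    not_false_eq_true]

/-- Semantics of one round of the binary search (probe vanishes: go low). [folklore] -/
theorem execOps_binBody₂ {W : ℕ} (mem : ℕ → ℕ) (hmh : mem 28 ≤ mem 26) (hhi : mem 26 < 2 ^ W)
    (hz : mem 29 ≤ 1) :
    (execOps W mem binBody₂) 26 = mem 26 - (mem 26 - mem 28) * mem 29 ∧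
      (execOps W mem binBody₂) 25 = mem 25 ∧ (execOps W mem binBody₂) 28 = mem 28 ∧
      (execOps W mem binBody₂) 29 = mem 29 ∧ (execOps W mem binBody₂) 18 = mem 18 ∧
      ∀ a, a ≠ 21 → a ≠ 26 → (execOps W mem binBody₂) a = mem a := by
  simp only [binBody₂, execOps_cons, execOps_nil, execOp_dir, Operand.read_dir,
    BinOp.eval]
  simp (config := { decide := true }) only [Function.update_self, Function.update_of_ne, ne_eq]
  have h1 : (mem 26 + 2 ^ W - mem 28 % 2 ^ W) % 2 ^ W = mem 26 - mem 28 := sub_eval_of_le hmh hhi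
  have h2 : (mem 26 - mem 28) * mem 29 < 2 ^ W := by
    rcases Nat.le_one_iff_eq_zero_or_eq_one.1 hz with h | h
    · simp [h]
    · simp [h]; omega
  have h3 : (mem 26 - mem 28) * mem 29 ≤ mem 26 := by
    rcases Nat.le_one_iff_eq_zero_or_eq_one.1 hz with h | h <;> simp [h]
  rw [h1, Nat.mod_eq_of_lt h2, sub_eval_of_le h3 hhi]
  refine ⟨by trivial, by trivial, by trivial, by trivial, by trivial, fun a h21 h26 => ?_⟩
  simp (config := { decide := true }) only [Function.update_of_ne, ne_eq, h21, h26, not_false_eq_true]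

/-- Semantics of one round of the binary search (probe nonzero: go high). [folklore] -/
theorem execOps_binBody₃ {W : ℕ} (mem : ℕ → ℕ) (hlm : mem 25 ≤ mem 28) (hmh : mem 28 ≤ mem 26)
    (hhi : mem 26 < 2 ^ W) (hz : mem 29 ≤ 1) :
    (execOps W mem binBody₃) 25 = mem 25 + (mem 28 - mem 25) * (1 - mem 29) ∧
      (execOps W mem binBody₃) 26 = mem 26 ∧
      (execOps W mem binBody₃) 27 = (mem 26 - (mem 25 + (mem 28 - mem 25) * (1 - mem 29))) >>> 1 ∧
      (execOps W mem binBody₃) 18 = mem 18 ∧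
      ∀ a, a ≠ 21 → a ≠ 25 → a ≠ 27 → a ≠ 29 → (execOps W mem binBody₃) a = mem a := by
  simp only [binBody₃, execOps_cons, execOps_nil, execOp_dir, Operand.read_dir, Operand.read_imm,
    BinOp.eval]
  simp (config := { decide := true }) only [Function.update_self, Function.update_of_ne, ne_eq]
  have h1 : (mem 28 + 2 ^ W - mem 25 % 2 ^ W) % 2 ^ W = mem 28 - mem 25 :=
    sub_eval_of_le hlm (by omega)
  have h2 : (mem 28 - mem 25) * (1 - mem 29) < 2 ^ W := by
    rcases Nat.le_one_iff_eq_zero_or_eq_one.1 hz with h | h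
    · simp [h]; omega
    · simp [h]
  have h3 : mem 25 + (mem 28 - mem 25) * (1 - mem 29) ≤ mem 26 := by
    rcases Nat.le_one_iff_eq_zero_or_eq_one.1 hz with h | h <;> simp [h] <;> omega
  have h4 : (mem 25 + (mem 28 - mem 25) * (1 - mem 29)) % 2 ^ W =
      mem 25 + (mem 28 - mem 25) * (1 - mem 29) := Nat.mod_eq_of_lt (by omega)
  rw [ite_eq_zero_eq_one_sub hz, h1, Nat.mod_eq_of_lt h2, h4, sub_eval_of_le h3 hhi]
  refine ⟨by trivial, by trivial, by trivial, by trivial, fun a h21 h25 h27 h29 => ?_⟩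
  simp (config := { decide := true }) only [Function.update_of_ne, ne_eq, h21, h25, h27, h29,
    not_false_eq_true]

/-- The binary-search body computes `bstep` on `(RLO, RHI)` and the new flag `(hi' - lo') >>> 1`. [folklore] -/
theorem execOps_binBody {W : ℕ} (mem : ℕ → ℕ) (hlh : mem 25 ≤ mem 26) (hhi : mem 26 < 2 ^ W) :
    (execOps W mem binBody) 25 = (bstep (mem 18) (mem 25, mem 26)).1 ∧
      (execOps W mem binBody) 26 = (bstep (mem 18) (mem 25, mem 26)).2 ∧
      (execOps W mem binBody) 27 =
        ((bstep (mem 18) (mem 25, mem 26)).2 - (bstep (mem 18) (mem 25, mem 26)).1) >>> 1 ∧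
      ∀ a, a ≠ 21 → a ≠ 25 → a ≠ 26 → a ≠ 27 → a ≠ 28 → a ≠ 29 →
        (execOps W mem binBody) a = mem a := by
  rw [show binBody = binBody₁ ++ binBody₂ ++ binBody₃ from rfl, execOps_append, execOps_append]
  obtain ⟨a28, a29, a25, a26, a18, af⟩ := execOps_binBody₁ mem hlh hhi
  set m₁ := execOps W mem binBody₁
  set lo := mem 25
  set hi := mem 26
  set v := mem 18
  set mid := lo + (hi - lo) / 2 with hmid_def
  set z : ℕ := if v >>> mid = 0 then 1 else 0 with hz
  have hz1 : z ≤ 1 := by rw [hz]; split_ifs <;> omega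
  have hmid : lo ≤ mid ∧ mid ≤ hi := ⟨Nat.le_add_right _ _, by omega⟩
  obtain ⟨b26, b25, b28, b29, b18, bf⟩ := execOps_binBody₂ (W := W) m₁ (by rw [a28, a26]; exact hmid.2)
    (by rw [a26]; exact hhi) (by rw [a29]; exact hz1)
  set m₂ := execOps W m₁ binBody₂
  rw [a25] at b25; rw [a26, a28, a29] at b26; rw [a28] at b28; rw [a29] at b29; rw [a18] at b18
  have hhi' : hi - (hi - mid) * z ≤ hi := Nat.sub_le _ _
  have hmid' : mid ≤ hi - (hi - mid) * z := by
    rcases Nat.le_one_iff_eq_zero_or_eq_one.1 hz1 with h | h <;> simp [h] <;> omega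
  obtain ⟨c25, c26, c27, -, cf⟩ := execOps_binBody₃ (W := W) m₂ (by rw [b25, b28]; exact hmid.1)
    (by rw [b28, b26]; exact hmid') (by rw [b26]; omega) (by rw [b29]; exact hz1)
  rw [b25, b28, b29] at c25; rw [b26] at c26; rw [b26, b25, b28, b29] at c27
  have hb : bstep v (lo, hi) = (lo + (mid - lo) * (1 - z), hi - (hi - mid) * z) := by
    simp only [bstep, hz]
    split_ifs with h <;> simp <;> omega
  rw [hb]
  refine ⟨c25, c26, c27, fun a h21 h25 h26 h27 h28 h29 => ?_⟩
  rw [cf a h21 h25 h27 h29, bf a h21 h26, af a h21 h27 h28 h29]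

/-- Semantics of the final power computation `2 ^ (kk * size)`. [folklore] -/
theorem execOps_powOps {W : ℕ} (mem : ℕ → ℕ) (kk : ℕ) (hk : kk * mem 26 < W) :
    (execOps W mem (powOps kk)) 30 = 2 ^ (kk * mem 26) ∧
      ∀ a, a ≠ 30 → (execOps W mem (powOps kk)) a = mem a := by
  simp only [powOps, execOps_cons, execOps_nil, execOp_dir, Operand.read_dir,
    Operand.read_imm, BinOp.eval]
  simp (config := { decide := true }) only [Function.update_self, ne_eq]
  have hlt : kk * mem 26 < 2 ^ W := lt_trans hk W.lt_two_pow_self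
  refine ⟨?_, fun a h30 => ?_⟩
  · rw [Nat.mul_comm, Nat.mod_eq_of_lt hlt, Nat.shiftLeft_eq, Nat.one_mul,
      Nat.mod_eq_of_lt (Nat.pow_lt_pow_right (by norm_num) hk)]
  · simp (config := { decide := true }) only [Function.update_of_ne, ne_eq, h30, not_false_eq_true]

/-! ### Value bounds -/

/-- The largest constant of a list of operations (`= Program.maxConst (ops.map OpSpec.toInstr)`).
[folklore] -/
def opsMaxConst (ops : List OpSpec) : ℕ := lmax (ops.map OpSpec.maxConst)

/-- The largest constant of a member is at most that of the list. [folklore] -/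
theorem maxConst_le_opsMaxConst {ops : List OpSpec} {s : OpSpec} (h : s ∈ ops) :
    s.maxConst ≤ opsMaxConst ops :=
  le_lmax_of_mem (List.mem_map.2 ⟨s, h, rfl⟩)

/-- Straight-line code with constants `≤ V` preserves `MemLE V` (`V ≥ 2 ^ W - 1`, `V ≥ 1`). [folklore] -/
theorem execOps_memLE_of_opsMaxConst {W V : ℕ} (hW : 2 ^ W - 1 ≤ V) (h1 : 1 ≤ V) {ops : List OpSpec}
    (hops : opsMaxConst ops ≤ V) {mem : ℕ → ℕ} (hm : MemLE V mem) : MemLE V (execOps W mem ops) :=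
  execOps_memLE hW h1 ops hm fun _ hs => le_trans (maxConst_le_opsMaxConst hs) hops

/-- Iterated straight-line code with constants `≤ V` preserves `MemLE V`. [folklore] -/
theorem iterate_execOps_memLE {W V : ℕ} (hW : 2 ^ W - 1 ≤ V) (h1 : 1 ≤ V) {ops : List OpSpec}
    (hops : opsMaxConst ops ≤ V) : ∀ (n : ℕ) {mem : ℕ → ℕ}, MemLE V mem →
      MemLE V ((fun m => execOps W m ops)^[n] mem)
  | 0, _, hm => hm
  | n + 1, _, hm => by
      rw [Function.iterate_succ_apply']
      exact execOps_memLE_of_opsMaxConst hW h1 hops (iterate_execOps_memLE hW h1 hops n hm)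

/-- Largest constant of `wInit`. [folklore] -/
theorem opsMaxConst_wInit : opsMaxConst wInit = 31 := by decide
/-- Largest constant of `scanBody`. [folklore] -/
theorem opsMaxConst_scanBody : opsMaxConst scanBody = 23 := by decide
/-- Largest constant of `expInit`. [folklore] -/
theorem opsMaxConst_expInit : opsMaxConst expInit = 24 := by decide
/-- Largest constant of `expBody`. [folklore] -/
theorem opsMaxConst_expBody : opsMaxConst expBody = 24 := by decide
/-- Largest constant of `binInit`. [folklore] -/
theorem opsMaxConst_binInit : opsMaxConst binInit = 27 := by decide
/-- Largest constant of `binBody`. [folklore] -/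
theorem opsMaxConst_binBody : opsMaxConst binBody = 29 := by decide
/-- Largest constant of `powOps kk`. [folklore] -/
theorem opsMaxConst_powOps (kk : ℕ) : opsMaxConst (powOps kk) = max 30 kk := by
  simp only [opsMaxConst, powOps, List.map_cons, List.map_nil, lmax_cons, lmax_nil,
    OpSpec.maxConst, OpSpec.toInstr, Instr.maxConst, Operand.const_dir, Operand.const_imm]
  omega

/-! ### The loops -/

/-- The scan loop: after `j ≤ L` rounds from `RV = v₀ < 2 ^ W`, `RQ = p`, `RC = L`,
`RV = max v₀ (lmax (readSeg mem p j))`, `RQ = p + j`, `RC = L - j`, other cells unchanged. [folklore] -/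
theorem iterate_scanBody {W : ℕ} {mem : ℕ → ℕ} {p L : ℕ} (hp : 24 ≤ p) (hpL : p + L < 2 ^ W)
    (hcells : ∀ j, j < L → mem (p + j) < 2 ^ W) (hv : mem 18 < 2 ^ W) (hq : mem 19 = p)
    (hc : mem 20 = L) :
    ∀ j, j ≤ L →
      ((fun m => execOps W m scanBody)^[j] mem) 18 = max (mem 18) (lmax (readSeg mem p j)) ∧
      ((fun m => execOps W m scanBody)^[j] mem) 19 = p + j ∧
      ((fun m => execOps W m scanBody)^[j] mem) 20 = L - j ∧
      ∀ a, a ≠ 18 → a ≠ 19 → a ≠ 20 → a ≠ 21 → a ≠ 22 → a ≠ 23 →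
        ((fun m => execOps W m scanBody)^[j] mem) a = mem a
  | 0, _ => by simp [readSeg, hq, hc]
  | j + 1, hj => by
      obtain ⟨h18, h19, h20, hf⟩ := iterate_scanBody hp hpL hcells hv hq hc j (by omega)
      rw [Function.iterate_succ_apply']
      set m := (fun m => execOps W m scanBody)^[j] mem
      have hL : L < 2 ^ W := by omega
      have hcell : m (m 19) < 2 ^ W := by
        rw [h19, hf _ (by omega) (by omega) (by omega) (by omega) (by omega) (by omega)]
        exact hcells j (by omega)
      have hmax : m 18 < 2 ^ W := by
        rw [h18]
        refine max_lt hv (lt_of_le_of_lt (lmax_le fun a ha => ?_) (show 2 ^ W - 1 < 2 ^ W by omega))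
        obtain ⟨i, hi, rfl⟩ := mem_readSeg_iff.1 ha
        have := hcells i (by omega); omega
      obtain ⟨e18, e19, e20, ef⟩ := execOps_scanBody (W := W) m hmax hcell (by omega) (by omega) (by omega)
      refine ⟨?_, by rw [e19, h19, Nat.add_assoc], by rw [e20, h20]; omega,
        fun a a18 a19 a20 a21 a22 a23 => by
          rw [ef a a18 a19 a20 a21 a22 a23, hf a a18 a19 a20 a21 a22 a23]⟩
      rw [e18, h18, h19, hf _ (by omega) (by omega) (by omega) (by omega) (by omega) (by omega),
        readSeg_succ, lmax_append, lmax_cons, lmax_nil, Nat.max_zero, max_assoc]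

/-- The exponential search: after `j ≤ expIters v` rounds from `RM = 1`, `RC = v >>> 1`
(`v = RV`, `2 * size v < 2 ^ W`), `RM = 2 ^ j` and `RC = v >>> 2 ^ j`. [folklore] -/
theorem iterate_expBody {W : ℕ} {mem : ℕ → ℕ} (hv1 : 1 ≤ mem 18) (hsz : 2 * Nat.size (mem 18) < 2 ^ W)
    (hm : mem 24 = 1) (hc : mem 20 = mem 18 >>> 1) :
    ∀ j, j ≤ expIters (mem 18) →
      ((fun m => execOps W m expBody)^[j] mem) 24 = 2 ^ j ∧
      ((fun m => execOps W m expBody)^[j] mem) 20 = mem 18 >>> 2 ^ j ∧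
      ∀ a, a ≠ 20 → a ≠ 24 → ((fun m => execOps W m expBody)^[j] mem) a = mem a
  | 0, _ => by simp [hm, hc]
  | j + 1, hj => by
      obtain ⟨h24, h20, hf⟩ := iterate_expBody hv1 hsz hm hc j (by omega)
      rw [Function.iterate_succ_apply']
      set m := (fun m => execOps W m expBody)^[j] mem
      have hpow : 2 ^ (j + 1) ≤ 2 ^ expIters (mem 18) := Nat.pow_le_pow_right (by norm_num) hj
      have hle := two_pow_expIters_le hv1
      have hlt : m 24 + m 24 < 2 ^ W := by rw [h24, ← Nat.two_mul, ← Nat.pow_succ']; omega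
      obtain ⟨e24, e20, ef⟩ := execOps_expBody (W := W) m hlt
      refine ⟨by rw [e24, h24, Nat.pow_succ]; omega, ?_, fun a a20 a24 => by rw [ef a a20 a24, hf a a20 a24]⟩
      rw [e20, hf _ (by omega) (by omega), h24, ← Nat.two_mul, ← Nat.pow_succ']

/-- The binary search: after `j ≤ e` rounds from `RLO = 0`, `RHI = 2 ^ e`, `RGAP = 2 ^ e >>> 1`
(`size v ≤ 2 ^ e < 2 ^ W`, `v = RV ≥ 1`), `(RLO, RHI) = bIter v e j` and
`RGAP = (RHI - RLO) >>> 1`. [folklore] -/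
theorem iterate_binBody {W : ℕ} {mem : ℕ → ℕ} {e : ℕ} (hv1 : 1 ≤ mem 18)
    (he : Nat.size (mem 18) ≤ 2 ^ e) (heW : 2 ^ e < 2 ^ W)
    (hlo : mem 25 = 0) (hhi : mem 26 = 2 ^ e) (hgap : mem 27 = 2 ^ e >>> 1) :
    ∀ j, j ≤ e →
      ((fun m => execOps W m binBody)^[j] mem) 25 = (bIter (mem 18) e j).1 ∧
      ((fun m => execOps W m binBody)^[j] mem) 26 = (bIter (mem 18) e j).2 ∧
      ((fun m => execOps W m binBody)^[j] mem) 27 =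
        ((bIter (mem 18) e j).2 - (bIter (mem 18) e j).1) >>> 1 ∧
      ∀ a, a ≠ 21 → a ≠ 25 → a ≠ 26 → a ≠ 27 → a ≠ 28 → a ≠ 29 →
        ((fun m => execOps W m binBody)^[j] mem) a = mem a
  | 0, _ => by simp [bIter, hlo, hhi, hgap]
  | j + 1, hj => by
      obtain ⟨h25, h26, h27, hf⟩ := iterate_binBody hv1 he heW hlo hhi hgap j (by omega)
      obtain ⟨i1, i2, i3, i4⟩ := bIter_inv hv1 he j (by omega)
      rw [Function.iterate_succ_apply']
      set m := (fun m => execOps W m binBody)^[j] mem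
      have hv : m 18 = mem 18 := hf _ (by omega) (by omega) (by omega) (by omega) (by omega) (by omega)
      obtain ⟨e25, e26, e27, ef⟩ := execOps_binBody (W := W) m (by rw [h25, h26]; omega)
        (by rw [h26]; omega)
      have hstep : bIter (mem 18) e (j + 1) = bstep (mem 18) (bIter (mem 18) e j) := by
        simp only [bIter, Function.iterate_succ_apply']
      rw [hv, h25, h26] at e25 e26 e27
      refine ⟨by rw [e25, hstep], by rw [e26, hstep], by rw [e27, hstep],
        fun a a21 a25 a26 a27 a28 a29 => by
          rw [ef a a21 a25 a26 a27 a28 a29, hf a a21 a25 a26 a27 a28 a29]⟩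

/-! ### The whole routine -/

/-- The cost of the width routine on a segment of length `L` at word size `W`. [folklore] -/
def widthCost (L W : ℕ) : ℕ := 9 * L + 20 * Nat.size W + 15

/-- **Specification of the width routine.** Placed at `i₀` and started at `pc = i₀` on a memory
whose cells are `< 2 ^ W`, with `L` in register `16`, `p ≥ 32` in register `31`,
`p + L < 2 ^ W` (hence `W ≥ 6`), and `kk * inputWidth q < W` for the segment `q = readSeg mem p L`,
the routine
reaches `pc = i₀ + 41` within `widthCost L W` steps with `2 ^ (kk * inputWidth q)` in register
`30`, `inputWidth q` in register `26`, all cells other than `18, …, 30` unchanged, and all cells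
still `< 2 ^ W`. [folklore] -/
theorem run_widthCode {P : Program} {W : ℕ} {O : List ℕ → List ℕ} {ρ : ℕ → ℕ} {i₀ kk : ℕ}
    (hcode : CodeAt P i₀ (widthCode i₀ kk)) {c : Cfg} (hpc : c.pc = some i₀)
    (hmem : ∀ a, c.mem a < 2 ^ W) {p L : ℕ} (hL : c.mem 16 = L) (hp : c.mem 31 = p) (hp32 : 32 ≤ p)
    (hpL : p + L < 2 ^ W) (hk : kk * inputWidth (readSeg c.mem p L) < W) :
    ∃ n, n ≤ widthCost L W ∧ ∃ mem' : ℕ → ℕ,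
      run P W O ρ n c = some { c with pc := some (i₀ + 41), mem := mem' } ∧
      mem' 30 = 2 ^ (kk * inputWidth (readSeg c.mem p L)) ∧
      mem' 26 = inputWidth (readSeg c.mem p L) ∧
      (∀ a, a < 18 ∨ 30 < a → mem' a = c.mem a) ∧
      ∀ a, mem' a < 2 ^ W := by
  -- `W ≥ 6` since `32 ≤ p < 2 ^ W`
  have hW : 6 ≤ W := by
    by_contra hW6
    have : 2 ^ W ≤ 2 ^ 5 := Nat.pow_le_pow_right (by norm_num) (by omega)
    omega
  -- code placement
  simp only [widthCode] at hcode
  obtain ⟨hc1, hc7⟩ := codeAt_append_iff.1 hcode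
  obtain ⟨hc1, hc6⟩ := codeAt_append_iff.1 hc1
  obtain ⟨hc1, hc5⟩ := codeAt_append_iff.1 hc1
  obtain ⟨hc1, hc4⟩ := codeAt_append_iff.1 hc1
  obtain ⟨hc1, hc3⟩ := codeAt_append_iff.1 hc1
  obtain ⟨hc1, hc2⟩ := codeAt_append_iff.1 hc1
  simp only [List.length_append, List.length_map, loopBlock_length, wInit_length, scanBody_length,
    expInit_length, expBody_length, binInit_length, binBody_length, Nat.reduceAdd]
    at hc2 hc3 hc4 hc5 hc6 hc7
  have h1lt : (1 : ℕ) < 2 ^ W := Nat.one_lt_two_pow (by omega)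
  have h2W := two_mul_lt_two_pow (show 3 ≤ W by omega)
  set q := readSeg c.mem p L with hq
  set v := max (max L 1) (lmax q) with hv
  have hv1 : 1 ≤ v := le_trans (le_max_right _ _) (le_max_left _ _)
  have hvW : v < 2 ^ W := by
    refine max_lt (max_lt (by omega) h1lt) (lt_of_le_of_lt (lmax_le fun a ha => ?_)
      (show 2 ^ W - 1 < 2 ^ W by omega))
    obtain ⟨i, hi, rfl⟩ := mem_readSeg_iff.1 ha
    have := hmem (p + i); omega
  have hsz : Nat.size v ≤ W := Nat.size_le.2 hvW
  have hwidth : inputWidth q = Nat.size v := by rw [inputWidth_eq_size, hv, hq, readSeg_length]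
  -- phase 1: set-up (5 steps)
  obtain ⟨a18, a20, a19, af⟩ := execOps_wInit (W := W) c.mem (by rw [hL]; omega)
  have r1 := run_ops (P := P) (w := W) (O := O) (ρ := ρ) wInit hc1 hpc
  set m1 := execOps W c.mem wInit
  -- phase 2: scan loop (9 L + 1 steps)
  have hcells : ∀ j, j < L → m1 (p + j) < 2 ^ W := fun j hj => by
    rw [af _ (by omega) (by omega) (by omega) (by omega)]; exact hmem _
  have hscan := iterate_scanBody (W := W) (mem := m1) (p := p) (L := L) (by omega) hpL hcells
    (by rw [a18, hL]; exact max_lt (by omega) h1lt) (by rw [a19, hp]) (by rw [a20, hL])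
  have r2 := run_while (P := P) (w := W) (O := O) (ρ := ρ) hc2 L
    (c := { c with pc := some (i₀ + 5), mem := m1 }) rfl
    (fun j hj => by have := (hscan j hj.le).2.2.1; simp only at this ⊢; rw [this]; omega)
    (by have := (hscan L le_rfl).2.2.1; simp only at this ⊢; rw [this]; omega)
  obtain ⟨b18, -, -, bf⟩ := hscan L le_rfl
  set m2 := (fun m => execOps W m scanBody)^[L] m1
  have hseg : readSeg m1 p L = q := readSeg_congr fun j hj =>
    (af _ (by omega) (by omega) (by omega) (by omega))
  have hv2 : m2 18 = v := by
    rw [b18, a18, hL, hseg]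
  -- phase 3: exp init (2 steps)
  obtain ⟨c24, c20, cf⟩ := execOps_expInit (W := W) m2
  have r3 := run_ops (P := P) (w := W) (O := O) (ρ := ρ) expInit hc3
    (c := { c with pc := some (i₀ + 14), mem := m2 }) rfl
  set m3 := execOps W m2 expInit
  have hv3 : m3 18 = v := by rw [cf _ (by omega) (by omega), hv2]
  -- phase 4: exp loop (`expIters v` rounds)
  have heS := expIters_le hv1
  have h2e := two_pow_expIters_le hv1
  have hexp := iterate_expBody (W := W) (mem := m3) (by rw [hv3]; exact hv1)
    (by rw [hv3]; omega) c24 (by rw [c20, hv2, hv3])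
  rw [hv3] at hexp
  have r4 := run_while (P := P) (w := W) (O := O) (ρ := ρ) hc4 (expIters v)
    (c := { c with pc := some (i₀ + 16), mem := m3 }) rfl
    (fun j hj => by
      have := (hexp j hj.le).2.1; simp only at this ⊢; rw [this]; exact expIters_min hj)
    (by have := (hexp _ le_rfl).2.1; simp only at this ⊢; rw [this]; exact expIters_spec v)
  obtain ⟨d24, -, df⟩ := hexp _ le_rfl
  set m4 := (fun m => execOps W m expBody)^[expIters v] m3
  have hv4 : m4 18 = v := by rw [df _ (by omega) (by omega), hv3]
  -- phase 5: bin init (3 steps)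
  obtain ⟨g25, g26, g27, gf⟩ := execOps_binInit (W := W) m4
  have r5 := run_ops (P := P) (w := W) (O := O) (ρ := ρ) binInit hc5
    (c := { c with pc := some (i₀ + 20), mem := m4 }) rfl
  set m5 := execOps W m4 binInit
  have hv5 : m5 18 = v := by rw [gf _ (by omega) (by omega) (by omega), hv4]
  -- phase 6: bin loop (`expIters v` rounds)
  have hsize_e : Nat.size v ≤ 2 ^ expIters v := size_le_two_pow_expIters v
  have heW : 2 ^ expIters v < 2 ^ W := by
    have : Nat.size v ≤ W := hsz
    omega
  have hbin := iterate_binBody (W := W) (mem := m5) (e := expIters v) (by rw [hv5]; exact hv1)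
    (by rw [hv5]; exact hsize_e) heW g25 (by rw [g26, d24]) (by rw [g27, d24])
  rw [hv5] at hbin
  have hinv := bIter_inv hv1 hsize_e
  have r6 := run_while (P := P) (w := W) (O := O) (ρ := ρ) hc6 (expIters v)
    (c := { c with pc := some (i₀ + 23), mem := m5 }) rfl
    (fun j hj => by
      have := (hbin j hj.le).2.2.1; simp only at this ⊢; rw [this]
      obtain ⟨-, -, h3, -⟩ := hinv j hj.le
      rw [h3, Nat.add_sub_cancel_left, Nat.shiftRight_eq_div_pow, Nat.pow_one]
      have : 2 ≤ 2 ^ (expIters v - j) := by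
        calc (2 : ℕ) = 2 ^ 1 := by norm_num
          _ ≤ 2 ^ (expIters v - j) := Nat.pow_le_pow_right (by norm_num) (by omega)
      omega)
    (by
      have := (hbin _ le_rfl).2.2.1; simp only at this ⊢; rw [this]
      obtain ⟨-, -, h3, -⟩ := hinv _ le_rfl
      rw [h3]; simp)
  obtain ⟨-, k26, -, kf⟩ := hbin _ le_rfl
  set m6 := (fun m => execOps W m binBody)^[expIters v] m5
  have hhi : m6 26 = Nat.size v := by rw [k26, bIter_final hv1 hsize_e]
  -- phase 7: output (2 steps)
  have hk' : kk * m6 26 < W := by rwa [hhi, ← hwidth]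
  obtain ⟨o30, of⟩ := execOps_powOps (W := W) m6 kk hk'
  have r7 := run_ops (P := P) (w := W) (O := O) (ρ := ρ) (powOps kk) hc7
    (c := { c with pc := some (i₀ + 39), mem := m6 }) rfl
  set m7 := execOps W m6 (powOps kk)
  -- normalise the seven run segments
  simp only [wInit_length, scanBody_length, expInit_length, expBody_length, binInit_length,
    binBody_length, powOps_length, Nat.add_assoc, Nat.reduceAdd] at r1 r2 r3 r4 r5 r6 r7
  -- assemble
  refine ⟨5 + ((L * 9 + 1) + (2 + ((expIters v * 4 + 1) + (3 + ((expIters v * 16 + 1) + 2))))),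
    ?_, m7, ?_, ?_, ?_, ?_, ?_⟩
  · -- cost
    have : expIters v ≤ Nat.size W := le_trans heS (Nat.size_le_size hsz)
    simp only [widthCost]; omega
  · exact run_add_of_run _ _ _ _ r1 (run_add_of_run _ _ _ _ r2 (run_add_of_run _ _ _ _ r3
      (run_add_of_run _ _ _ _ r4 (run_add_of_run _ _ _ _ r5 (run_add_of_run _ _ _ _ r6 r7)))))
  · rw [o30, hhi, hwidth]
  · rw [of _ (by omega), hhi, hwidth]
  · intro a ha
    rw [of _ (by omega), kf _ (by omega) (by omega) (by omega) (by omega) (by omega) (by omega),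
      gf _ (by omega) (by omega) (by omega), df _ (by omega) (by omega), cf _ (by omega) (by omega),
      bf _ (by omega) (by omega) (by omega) (by omega) (by omega) (by omega),
      af _ (by omega) (by omega) (by omega) (by omega)]
  · -- all cells stay below `2 ^ W`: every phase only writes words, copies of cells, or its constants
    have hV1 : 1 ≤ 2 ^ W - 1 := by omega
    have h31 : 31 ≤ 2 ^ W - 1 := by
      have : 2 ^ 5 ≤ 2 ^ W := Nat.pow_le_pow_right (by norm_num) (by omega)
      omega
    have hkk : kk ≤ 2 ^ W - 1 := by
      have hiw : 1 ≤ inputWidth q := inputWidth_pos q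
      have : kk ≤ kk * inputWidth q := Nat.le_mul_of_pos_right _ hiw
      have := W.lt_two_pow_self
      omega
    have b0 : MemLE (2 ^ W - 1) c.mem := fun a => by have := hmem a; omega
    have b1 : MemLE (2 ^ W - 1) m1 :=
      execOps_memLE_of_opsMaxConst le_rfl hV1 (by rw [opsMaxConst_wInit]; exact h31) b0
    have b2 : MemLE (2 ^ W - 1) m2 :=
      iterate_execOps_memLE le_rfl hV1 (by rw [opsMaxConst_scanBody]; omega) _ b1
    have b3 : MemLE (2 ^ W - 1) m3 :=
      execOps_memLE_of_opsMaxConst le_rfl hV1 (by rw [opsMaxConst_expInit]; omega) b2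
    have b4 : MemLE (2 ^ W - 1) m4 :=
      iterate_execOps_memLE le_rfl hV1 (by rw [opsMaxConst_expBody]; omega) _ b3
    have b5 : MemLE (2 ^ W - 1) m5 :=
      execOps_memLE_of_opsMaxConst le_rfl hV1 (by rw [opsMaxConst_binInit]; omega) b4
    have b6 : MemLE (2 ^ W - 1) m6 :=
      iterate_execOps_memLE le_rfl hV1 (by rw [opsMaxConst_binBody]; omega) _ b5
    have b7 : MemLE (2 ^ W - 1) m7 :=
      execOps_memLE_of_opsMaxConst le_rfl hV1 (by rw [opsMaxConst_powOps]; exact max_le (by omega) hkk) b6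
    intro a
    have := b7 a
    omega

end widthCode

end Literature.Computability.Cryptography.WordRAM
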